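import Literature.NumberTheory.Automorphic.UnitaryGroupTruncatedKernelDifference
import Literature.NumberTheory.Automorphic.UnitaryGroupBorelCosetSumUnfolding
import HarnessLib

/-!
# `J^{T'}(f) − J^{T}(f)` unfolded to the group: the four nonnegative parts of the window `1_{T<H≤T'} K_B`
# integrated against a covering weight of `B(F)` (Bochner ⇄ lintegral bridge of the polynomiality road)
(Rogawski, *Automorphic Representations of Unitary Groups in Three Variables* (1990), §2.1 p. 12, §2.2
p. 13; Arthur, *The trace formula in invariant form*, Ann. of Math. 114 (1981), Prop. 2.3; Gelbart,
*Automorphic forms on adele groups* (1975), §9.B (9.40)–(9.48): the unfolding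
`∫_{G_ℚ \ G_𝔸} Σ_{B_ℚ \ G_ℚ} φ(δ x) dx = ∫_{B_ℚ \ G_𝔸} φ`)

Topic `NumberTheory/Automorphic`; namespace `Literature.NumberTheory.Automorphic.UnitaryGroup`. THEOREMS
ONLY over accepted tree modules: no definition, no named fact, no `sorry`, no instance, no notation.
Brick (L2-uℂ) of the road to ★ `UnitaryGroup.TruncatedTracePolynomial` («`J^T(f)` is a polynomial in
`log T` of degree `≤ 1`»). The road runs in `ℝ≥0∞` (lintegrals); Arthur's distribution
`J^T(f) = truncatedTrace μ ν 𝓕 T f = ∫_{G(F)\G(𝔸)} k^T` is a complex Bochner integral. This file is the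
bridge: with the WINDOW `window(y) = 1_{T < H(y) ≤ T'} K_B(y, y)` (★ L2-a letters, no definition) and its
four nonnegative parts `w₁ = (Re window)⁺`, `w₂ = (Re window)⁻`, `w₃ = (Im window)⁺`, `w₄ = (Im window)⁻`
(written `ENNReal.ofReal (±(window y).re∕im)` — `ofReal` clips at `0`),

  `J^{T'}(f) − J^{T}(f) = [(C ∫⁻ β w₁).toReal − (C ∫⁻ β w₂).toReal] + i [(C ∫⁻ β w₃).toReal − (C ∫⁻ β w₄).toReal]`

for every covering weight `β` of `B(F)♯ ≤ G(𝔸_F)`, every `1 ≤ T ≤ T'` at which `k^T`, `k^{T'}` are integrable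
(law 1 ★ `TruncatedKernelIntegrable`), with ONE constant `C ≠ ∞` (Weil's, from ★ L2-u) for all windows,
and each `∫⁻_{G(𝔸)} β w_j dν_G` finite.

* §1 THE COLLAPSE of the window's coset sums in `ℝ≥0∞` (Siegel property ★
  `not_lt_borelHeight_mul_of_not_mem_arithmeticBorel`: for `1 ≤ T < H(γ y)` the class `B(F) γ` is the ONLY
  class of `B(F)\G(F)` above `T` at `y`): `tsum_borelQuotient_eq_of_lt` (`Σ'_q ψ(q̃ y) = ψ(γ y)`),
  `tsum_borelQuotient_eq_zero` — for `ψ ≥ 0` left-`B(F)`-invariant vanishing off `{T < H}`.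
* §2 the parts of the window: measurable, left-`B(F)`-invariant, vanishing off `{T < H}`, and POINTWISE
  `ofReal (±re∕im (pseudoEisenstein window y)) = Σ'_q w_j(q̃ y)` (`ofReal_re_pseudoEisenstein_window_eq_tsum` &c.,
  over ★ `pseudoEisenstein_window_eq_self ∕ _eq_zero ∕ _rational_mul`).
* §3 **`exists_truncatedTrace_sub_eq_parts`** — THE BRIDGE (`D = quotFun k^{T'} − quotFun k^{T}` is
  `μ`-integrable; `∫ D = ∫ Re D + i ∫ Im D`; `∫ Re D = (∫⁻ (Re D)⁺).toReal − (∫⁻ (Re D)⁻).toReal`; pointwise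
  `D(x) = pseudoEisenstein window (x̃⁻¹)` by ★ `truncatedKernel_sub_truncatedKernel` and the definition of
  `quotFun`; §2; ★ L2-u `exists_ne_zero_lintegral_tsum_borelQuotient_eq_mul_lintegral`, whose `C ≠ 0` turns the
  finiteness of `∫⁻_X (Re D)^± dμ` into that of `∫⁻_G β w_j dν_G`).

## References

* J. D. Rogawski, *Automorphic Representations of Unitary Groups in Three Variables*, Annals of
  Mathematics Studies 123 (1990), §2.1 (p. 12), §2.2 (p. 13) [Rogawski1990].
* J. Arthur, *The trace formula in invariant form*, Ann. of Math. 114 (1981), Prop. 2.3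
  [Arthur1981TraceFormulaInvariantForm].
* S. Gelbart, *Automorphic forms on adele groups*, Annals of Mathematics Studies 83 (1975), §9.B
  [Gelbart1975].
-/

set_option autoImplicit false

noncomputable section

open MeasureTheory Measure NumberField IsDedekindDomain Set
open Literature.MeasureTheory.Group
open scoped NNReal ENNReal Pointwise

namespace Literature.NumberTheory.Automorphic

namespace UnitaryGroup

variable {F E : Type} [Field F] [NumberField F] [Field E] [NumberField E] [Algebra F E]
  {c : E ≃ₐ[F] E}

/-! ## §1 The collapse of a coset sum above the Siegel threshold -/

/-- On the fibre of `q ∈ B(F)\G(F)` a left-`B(F)`-invariant `ψ` is constant: `ψ(q̃ y) = ψ(γ y)` for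
`B(F) γ = q`. [folklore] -/
private theorem apply_out_mk_mul {ψ : (quasiSplit F E c 3).Adelic → ℝ≥0∞}
    (hψ : ∀ b ∈ arithmeticBorel F E c 3, ∀ y : (quasiSplit F E c 3).Adelic,
      ψ ((b : (quasiSplit F E c 3).Adelic) * y) = ψ y)
    (γ : (quasiSplit F E c 3).arithmeticSubgroup) (y : (quasiSplit F E c 3).Adelic) :
    ψ ((((Quotient.mk (QuotientGroup.rightRel (arithmeticBorel F E c 3)) γ).out :
        (quasiSplit F E c 3).arithmeticSubgroup) : (quasiSplit F E c 3).Adelic) * y) =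
      ψ ((γ : (quasiSplit F E c 3).Adelic) * y) := by
  set δ := (Quotient.mk (QuotientGroup.rightRel (arithmeticBorel F E c 3)) γ).out with hδ
  have hrel : γ * δ⁻¹ ∈ arithmeticBorel F E c 3 := by
    have h : @Setoid.r _ (QuotientGroup.rightRel (arithmeticBorel F E c 3)) δ γ :=
      Quotient.mk_out (s := QuotientGroup.rightRel (arithmeticBorel F E c 3)) γ
    exact QuotientGroup.rightRel_apply.1 h
  have hδγ : (δ : (quasiSplit F E c 3).Adelic) =
      ((γ * δ⁻¹)⁻¹ : (quasiSplit F E c 3).arithmeticSubgroup) * (γ : (quasiSplit F E c 3).Adelic) := by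
    push_cast
    group
  rw [hδγ, mul_assoc, hψ _ (Subgroup.inv_mem _ hrel)]

/-- **THE COLLAPSE ABOVE THE THRESHOLD.** Let `ψ ≥ 0` on `U(J₃)(𝔸_F)` be left-`B(F)`-invariant and vanish
off `{T < H}`, `1 ≤ T`. If `T < H(γ y)` for some `γ ∈ G(F)`, then `Σ'_{q ∈ B(F)\G(F)} ψ(q̃ y) = ψ(γ y)`: by the
Siegel property ★ `not_lt_borelHeight_mul_of_not_mem_arithmeticBorel` no class other than `B(F) γ` is above
`T` at `y`. [cite: Rogawski1990, §2.2 (p. 13)] -/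
theorem tsum_borelQuotient_eq_of_lt {ψ : (quasiSplit F E c 3).Adelic → ℝ≥0∞}
    (hψ : ∀ b ∈ arithmeticBorel F E c 3, ∀ y : (quasiSplit F E c 3).Adelic,
      ψ ((b : (quasiSplit F E c 3).Adelic) * y) = ψ y)
    {T : ℝ≥0} (hT : 1 ≤ T)
    (hψT : ∀ z : (quasiSplit F E c 3).Adelic, ¬T < borelHeight z → ψ z = 0)
    {y : (quasiSplit F E c 3).Adelic} {γ : (quasiSplit F E c 3).arithmeticSubgroup}
    (hγ : T < borelHeight ((γ : (quasiSplit F E c 3).Adelic) * y)) :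
    ∑' q : Quotient (QuotientGroup.rightRel (arithmeticBorel F E c 3)),
        ψ (((q.out : (quasiSplit F E c 3).arithmeticSubgroup) : (quasiSplit F E c 3).Adelic) * y) =
      ψ ((γ : (quasiSplit F E c 3).Adelic) * y) := by
  classical
  rw [tsum_eq_single (Quotient.mk (QuotientGroup.rightRel (arithmeticBorel F E c 3)) γ)]
  · exact apply_out_mk_mul hψ γ y
  · intro q hq
    -- `q̃ γ⁻¹ ∉ B(F)`, so `q̃ y = (q̃ γ⁻¹)(γ y)` is not above `T`
    have hnot : q.out * γ⁻¹ ∉ arithmeticBorel F E c 3 := by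
      intro hmem
      apply hq
      rw [← Quotient.out_eq q]
      refine (Quotient.sound ?_).symm
      change @Setoid.r _ (QuotientGroup.rightRel (arithmeticBorel F E c 3)) γ q.out
      rw [QuotientGroup.rightRel_apply]
      exact hmem
    have hlt := not_lt_borelHeight_mul_of_not_mem_arithmeticBorel hnot hT hγ
    have heq : ((q.out * γ⁻¹ : (quasiSplit F E c 3).arithmeticSubgroup) : (quasiSplit F E c 3).Adelic) *
        ((γ : (quasiSplit F E c 3).Adelic) * y) =
        ((q.out : (quasiSplit F E c 3).arithmeticSubgroup) : (quasiSplit F E c 3).Adelic) * y := by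
      push_cast
      group
    rw [heq] at hlt
    exact hψT _ hlt

/-- **THE COLLAPSE BELOW THE THRESHOLD.** If `ψ ≥ 0` vanishes off `{T < H}` and no `γ y`, `γ ∈ G(F)`, is
above `T`, then `Σ'_{q ∈ B(F)\G(F)} ψ(q̃ y) = 0`. [cite: Rogawski1990, §2.2 (p. 13)] -/
theorem tsum_borelQuotient_eq_zero {ψ : (quasiSplit F E c 3).Adelic → ℝ≥0∞} {T : ℝ≥0}
    (hψT : ∀ z : (quasiSplit F E c 3).Adelic, ¬T < borelHeight z → ψ z = 0)
    {y : (quasiSplit F E c 3).Adelic}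
    (hy : ∀ γ : (quasiSplit F E c 3).arithmeticSubgroup,
      borelHeight ((γ : (quasiSplit F E c 3).Adelic) * y) ≤ T) :
    ∑' q : Quotient (QuotientGroup.rightRel (arithmeticBorel F E c 3)),
        ψ (((q.out : (quasiSplit F E c 3).arithmeticSubgroup) : (quasiSplit F E c 3).Adelic) * y) = 0 :=
  ENNReal.tsum_eq_zero.2 fun q => hψT _ (not_lt.2 (hy q.out))

/-! ## §2 The four parts of the window and their coset sums -/

section Window

variable [MeasurableSpace (adelicUnipotent F E c 3)] [BorelSpace (adelicUnipotent F E c 3)]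

/-- **POINTWISE: the clipped real∕imaginary parts of the window's pseudo-Eisenstein series are the coset
sums of the clipped parts of the window.** For `1 ≤ T ≤ T'`, every `y`, and every monotone-in-zero map
`φ : ℂ → ℝ` with `φ 0 = 0` … concretely for `φ ∈ {re, −re, im, −im}`:
`ofReal (φ (pseudoEisenstein window y)) = Σ'_{q ∈ B(F)\G(F)} ofReal (φ (window (q̃ y)))` — above the
threshold both sides are the value at the unique class above `T` (★ `pseudoEisenstein_window_eq_self`,
`tsum_borelQuotient_eq_of_lt`), below it both vanish (★ `pseudoEisenstein_window_eq_zero`,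
`tsum_borelQuotient_eq_zero`). [cite: Rogawski1990, §2.2 (p. 13)] -/
theorem ofReal_comp_pseudoEisenstein_window_eq_tsum (ν : Measure (adelicUnipotent F E c 3)) [ν.IsHaarMeasure]
    {𝓕 : Set (adelicUnipotent F E c 3)} (h𝓕 : IsFundamentalDomain (rationalUnipotent F E c 3) 𝓕 ν)
    (f : (quasiSplit F E c 3).Adelic → ℂ) {T T' : ℝ≥0} (hT : 1 ≤ T) (hTT' : T ≤ T')
    (φ : ℂ → ℝ) (hφ : φ 0 = 0) (y : (quasiSplit F E c 3).Adelic) :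
    ENNReal.ofReal (φ (pseudoEisenstein
        ({y : (quasiSplit F E c 3).Adelic | T < borelHeight y ∧ borelHeight y ≤ T'}.indicator
          (fun y => kernelBorel ν 𝓕 f y y)) y)) =
      ∑' q : Quotient (QuotientGroup.rightRel (arithmeticBorel F E c 3)),
        ENNReal.ofReal (φ ({y : (quasiSplit F E c 3).Adelic | T < borelHeight y ∧ borelHeight y ≤ T'}.indicator
          (fun y => kernelBorel ν 𝓕 f y y)
            (((q.out : (quasiSplit F E c 3).arithmeticSubgroup) : (quasiSplit F E c 3).Adelic) * y))) := by
  set W : (quasiSplit F E c 3).Adelic → ℂ :=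
    {y : (quasiSplit F E c 3).Adelic | T < borelHeight y ∧ borelHeight y ≤ T'}.indicator
      (fun y => kernelBorel ν 𝓕 f y y) with hW
  -- the part `ψ = ofReal ∘ φ ∘ W` is left-`B(F)`-invariant and vanishes off `{T < H}`
  have hψB : ∀ b ∈ arithmeticBorel F E c 3, ∀ z : (quasiSplit F E c 3).Adelic,
      ENNReal.ofReal (φ (W ((b : (quasiSplit F E c 3).Adelic) * z))) = ENNReal.ofReal (φ (W z)) := by
    intro b hb z
    rw [hW, window_rational_borel_mul ν h𝓕 f hTT' b hb z]
  have hψT : ∀ z : (quasiSplit F E c 3).Adelic, ¬T < borelHeight z → ENNReal.ofReal (φ (W z)) = 0 := by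
    intro z hz
    rw [hW, window_of_not_lt ν 𝓕 f hz, hφ, ENNReal.ofReal_zero]
  by_cases h : ∃ γ : (quasiSplit F E c 3).arithmeticSubgroup,
      T < borelHeight ((γ : (quasiSplit F E c 3).Adelic) * y)
  · obtain ⟨γ, hγ⟩ := h
    rw [tsum_borelQuotient_eq_of_lt hψB hT hψT hγ, hW,
      ← pseudoEisenstein_window_rational_mul ν h𝓕 f hTT' γ y,
      pseudoEisenstein_window_eq_self ν h𝓕 f hT hTT' hγ]
  · simp only [not_exists, not_lt] at h
    rw [tsum_borelQuotient_eq_zero hψT h, hW, pseudoEisenstein_window_eq_zero ν 𝓕 f h, hφ,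
      ENNReal.ofReal_zero]

end Window

/-! ## §3 The bridge -/

omit [NumberField F] [Algebra F E] in
/-- `𝔸_E` is Hausdorff (local copy of the standard three-line argument). [folklore] -/
private theorem t2Space_adeleRing_E₁₂ : T2Space (AdeleRing (𝓞 E) E) := by
  haveI : T2Space (FiniteAdeleRing (𝓞 E) E) := inferInstanceAs <| T2Space
    (RestrictedProduct (fun w : HeightOneSpectrum (𝓞 E) => w.adicCompletion E)
      (fun w => (w.adicCompletionIntegers E : Set (w.adicCompletion E))) Filter.cofinite)
  haveI : T2Space (InfiniteAdeleRing E) :=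
    inferInstanceAs <| T2Space ((w : InfinitePlace E) → w.Completion)
  exact inferInstanceAs <| T2Space (InfiniteAdeleRing E × FiniteAdeleRing (𝓞 E) E)

section Bridge

variable [MeasurableSpace (adelicUnipotent F E c 3)] [BorelSpace (adelicUnipotent F E c 3)]
  [MeasurableSpace (quasiSplit F E c 3).Adelic] [BorelSpace (quasiSplit F E c 3).Adelic]

/-- **`J^{T'}(f) − J^{T}(f)` AS FOUR UNFOLDED NONNEGATIVE INTEGRALS.** For a Haar measure `ν` of `N(𝔸_F)`,
a fundamental domain `𝓕` of `N(F)`, an automorphic measure `μ` on `G(F)\G(𝔸_F)`, an inversion-invariant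
Haar measure `ν_G` of `G(𝔸_F) = U(J₃)(𝔸_F)`, a continuous compactly supported `f` and a covering weight `β`
of `B(F)♯`, there is ONE constant `C ≠ ∞` such that for all `1 ≤ T ≤ T'` at which `k^T` and `k^{T'}` are
integrable: the four integrals `∫⁻_{G(𝔸)} β w_j dν_G` of the parts of the window `1_{T<H≤T'} K_B` are finite
and `J^{T'}(f) − J^{T}(f) = [(C∫⁻βw₁).toReal − (C∫⁻βw₂).toReal] + i[(C∫⁻βw₃).toReal − (C∫⁻βw₄).toReal]`
(`D = quotFun k^{T'} − quotFun k^T` integrable; `∫ D = ∫ Re D + i ∫ Im D`; positive and negative parts; the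
definition of `quotFun` as evaluation at `x̃⁻¹`; ★ `truncatedKernel_sub_truncatedKernel`; §2; ★ L2-u with
`C ≠ 0`). [cite: Rogawski1990, §2.1 (p. 12)] [cite: Arthur1981TraceFormulaInvariantForm, Prop. 2.3] -/
theorem exists_truncatedTrace_sub_eq_parts (ν : Measure (adelicUnipotent F E c 3)) [ν.IsHaarMeasure]
    {𝓕 : Set (adelicUnipotent F E c 3)} (h𝓕 : IsFundamentalDomain (rationalUnipotent F E c 3) 𝓕 ν)
    (μ : Measure (quasiSplit F E c 3).automorphicQuotient) [(quasiSplit F E c 3).IsAutomorphicMeasure μ]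
    (νG : Measure (quasiSplit F E c 3).Adelic) [νG.IsHaarMeasure] [νG.IsInvInvariant]
    (f : (quasiSplit F E c 3).Adelic → ℂ) (hfc : Continuous f) (hf : HasCompactSupport f)
    {β : (quasiSplit F E c 3).Adelic → ℝ≥0∞}
    (hβ : IsCoveringWeight ((arithmeticBorel F E c 3).map (quasiSplit F E c 3).arithmeticSubgroup.subtype) β) :
    ∃ C : ℝ≥0∞, C ≠ ⊤ ∧ ∀ T T' : ℝ≥0, 1 ≤ T → T ≤ T' →
      Integrable ((quasiSplit F E c 3).quotFun (truncatedKernel ν 𝓕 T f)) μ →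
      Integrable ((quasiSplit F E c 3).quotFun (truncatedKernel ν 𝓕 T' f)) μ →
      (∫⁻ y, β y * ENNReal.ofReal
          ({y : (quasiSplit F E c 3).Adelic | T < borelHeight y ∧ borelHeight y ≤ T'}.indicator
            (fun y => kernelBorel ν 𝓕 f y y) y).re ∂νG ≠ ⊤ ∧
       ∫⁻ y, β y * ENNReal.ofReal
          (-({y : (quasiSplit F E c 3).Adelic | T < borelHeight y ∧ borelHeight y ≤ T'}.indicator
            (fun y => kernelBorel ν 𝓕 f y y) y).re) ∂νG ≠ ⊤ ∧
       ∫⁻ y, β y * ENNReal.ofReal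
          ({y : (quasiSplit F E c 3).Adelic | T < borelHeight y ∧ borelHeight y ≤ T'}.indicator
            (fun y => kernelBorel ν 𝓕 f y y) y).im ∂νG ≠ ⊤ ∧
       ∫⁻ y, β y * ENNReal.ofReal
          (-({y : (quasiSplit F E c 3).Adelic | T < borelHeight y ∧ borelHeight y ≤ T'}.indicator
            (fun y => kernelBorel ν 𝓕 f y y) y).im) ∂νG ≠ ⊤) ∧
      truncatedTrace μ ν 𝓕 T' f - truncatedTrace μ ν 𝓕 T f =
        (((C * ∫⁻ y, β y * ENNReal.ofReal
            ({y : (quasiSplit F E c 3).Adelic | T < borelHeight y ∧ borelHeight y ≤ T'}.indicator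
              (fun y => kernelBorel ν 𝓕 f y y) y).re ∂νG).toReal -
          (C * ∫⁻ y, β y * ENNReal.ofReal
            (-({y : (quasiSplit F E c 3).Adelic | T < borelHeight y ∧ borelHeight y ≤ T'}.indicator
              (fun y => kernelBorel ν 𝓕 f y y) y).re) ∂νG).toReal : ℝ) : ℂ) +
        (((C * ∫⁻ y, β y * ENNReal.ofReal
            ({y : (quasiSplit F E c 3).Adelic | T < borelHeight y ∧ borelHeight y ≤ T'}.indicator
              (fun y => kernelBorel ν 𝓕 f y y) y).im ∂νG).toReal -
          (C * ∫⁻ y, β y * ENNReal.ofReal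
            (-({y : (quasiSplit F E c 3).Adelic | T < borelHeight y ∧ borelHeight y ≤ T'}.indicator
              (fun y => kernelBorel ν 𝓕 f y y) y).im) ∂νG).toReal : ℝ) : ℂ) * Complex.I := by
  classical
  -- `N(𝔸_F)` closed ⇒ second countable, locally compact; `ν` s-finite (for measurability of `K_B`)
  haveI := secondCountableTopology_adeleRing E
  haveI := locallyCompactSpace_adeleRing' E
  haveI := t2Space_adeleRing_E₁₂ (E := E)
  haveI : T2Space (quasiSplit F E c 3).Adelic :=
    inferInstanceAs (T2Space (adelic F E c 3 ((StdForm.antidiagonal 3).over E)))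
  haveI : LocallyCompactSpace (quasiSplit F E c 3).Adelic :=
    inferInstanceAs (LocallyCompactSpace (adelic F E c 3 ((StdForm.antidiagonal 3).over E)))
  haveI : SecondCountableTopology (quasiSplit F E c 3).Adelic :=
    inferInstanceAs (SecondCountableTopology (adelic F E c 3 ((StdForm.antidiagonal 3).over E)))
  have hNcl : IsClosed ((adelicUnipotent F E c 3 : Set (quasiSplit F E c 3).Adelic)) := by
    change IsClosed (⇑(adelicVal F E c 3 ((StdForm.antidiagonal 3).over E)) ⁻¹'
      ((upperUnitriangular (Fin 3) (AdeleRing (𝓞 E) E) : Subgroup (GL (Fin 3) (AdeleRing (𝓞 E) E))) :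
        Set (GL (Fin 3) (AdeleRing (𝓞 E) E))))
    exact (isClosed_upperUnitriangular (R := AdeleRing (𝓞 E) E)).preimage continuous_subtype_val
  haveI : SecondCountableTopology (adelicUnipotent F E c 3) := TopologicalSpace.Subtype.secondCountableTopology _
  haveI : LocallyCompactSpace (adelicUnipotent F E c 3) := hNcl.locallyCompactSpace
  haveI : SFinite ν := inferInstance
  -- the unfolding constant `C ≠ 0, ≠ ∞` of ★ L2-u
  obtain ⟨C, hC0, hCtop, hunf⟩ :=
    exists_ne_zero_lintegral_tsum_borelQuotient_eq_mul_lintegral (F := F) (E := E) (c := c) μ νG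
  refine ⟨C, hCtop, fun T T' hT hTT' hint hint' => ?_⟩
  -- the window and its measurability
  set W : (quasiSplit F E c 3).Adelic → ℂ :=
    {y : (quasiSplit F E c 3).Adelic | T < borelHeight y ∧ borelHeight y ≤ T'}.indicator
      (fun y => kernelBorel ν 𝓕 f y y) with hW
  have hWm : Measurable W := by
    refine (measurable_kernelBorel_diag hfc hf ν 𝓕).indicator ?_
    have h1 := measurableSet_setOf_lt_borelHeight (F := F) (E := E) (c := c) (N := 3) T
    have h2 := measurableSet_setOf_lt_borelHeight (F := F) (E := E) (c := c) (N := 3) T'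
    have hset : {y : (quasiSplit F E c 3).Adelic | T < borelHeight y ∧ borelHeight y ≤ T'} =
        {y : (quasiSplit F E c 3).Adelic | T < borelHeight y} \ {y | T' < borelHeight y} := by
      ext y
      simp only [Set.mem_setOf_eq, Set.mem_sdiff, not_lt]
    rw [hset]
    exact h1.diff h2
  -- the four parts `ψφ = ofReal ∘ φ ∘ W`, `φ ∈ {re, −re, im, −im}`: measurable and `B(F)`-invariant
  have hpart : ∀ φ : ℂ → ℝ, Measurable φ → φ 0 = 0 →
      Measurable (fun y => ENNReal.ofReal (φ (W y))) ∧
      (∀ b ∈ arithmeticBorel F E c 3, ∀ z : (quasiSplit F E c 3).Adelic,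
        ENNReal.ofReal (φ (W ((b : (quasiSplit F E c 3).Adelic) * z))) = ENNReal.ofReal (φ (W z))) := by
    intro φ hφm hφ0
    refine ⟨ENNReal.measurable_ofReal.comp (hφm.comp hWm), fun b hb z => ?_⟩
    rw [hW, window_rational_borel_mul ν h𝓕 f hTT' b hb z]
  -- the unfolded identity for one part: `∫⁻_X ofReal (φ (D x)) dμ = C ∫⁻ β ψφ`, where `D(x) = Ψ_W(x̃⁻¹)`
  set D : (quasiSplit F E c 3).automorphicQuotient → ℂ := fun x =>
    (quasiSplit F E c 3).quotFun (truncatedKernel ν 𝓕 T' f) x -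
      (quasiSplit F E c 3).quotFun (truncatedKernel ν 𝓕 T f) x with hD
  have hDW : ∀ x : (quasiSplit F E c 3).automorphicQuotient,
      D x = pseudoEisenstein W ((Quotient.out x : (quasiSplit F E c 3).Adelic)⁻¹) := fun x =>
    truncatedKernel_sub_truncatedKernel ν h𝓕 f hT hTT' _
  have hDint : Integrable D μ := hint'.sub hint
  have hlin : ∀ φ : ℂ → ℝ, Measurable φ → φ 0 = 0 →
      ∫⁻ x, ENNReal.ofReal (φ (D x)) ∂μ = C * ∫⁻ y, β y * ENNReal.ofReal (φ (W y)) ∂νG := by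
    intro φ hφm hφ0
    obtain ⟨hψm, hψB⟩ := hpart φ hφm hφ0
    rw [← hunf β hβ _ hψm hψB]
    refine lintegral_congr fun x => ?_
    rw [hDW x, hW]
    exact ofReal_comp_pseudoEisenstein_window_eq_tsum ν h𝓕 f hT hTT' φ hφ0 _
  -- finiteness: `C ∫⁻ β ψφ = ∫⁻_X ofReal (φ D) ≤ ∫⁻_X ‖D‖ₑ < ∞`, and `C ≠ 0`
  have hfin : ∀ φ : ℂ → ℝ, Measurable φ → φ 0 = 0 → (∀ z : ℂ, φ z ≤ ‖z‖) →
      ∫⁻ y, β y * ENNReal.ofReal (φ (W y)) ∂νG ≠ ⊤ := by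
    intro φ hφm hφ0 hφle
    have hle : C * ∫⁻ y, β y * ENNReal.ofReal (φ (W y)) ∂νG ≤ ∫⁻ x, ‖D x‖ₑ ∂μ := by
      rw [← hlin φ hφm hφ0]
      refine lintegral_mono fun x => ?_
      rw [← ofReal_norm]
      exact ENNReal.ofReal_le_ofReal (hφle _)
    exact (ENNReal.lt_top_of_mul_ne_top_right (ne_top_of_le_ne_top hDint.2.ne hle) hC0).ne
  -- the four `φ`
  have hre0 : (fun z : ℂ => z.re) 0 = 0 := Complex.zero_re
  have hnre0 : (fun z : ℂ => -z.re) 0 = 0 := by simp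
  have him0 : (fun z : ℂ => z.im) 0 = 0 := Complex.zero_im
  have hnim0 : (fun z : ℂ => -z.im) 0 = 0 := by simp
  have hrem : Measurable fun z : ℂ => z.re := Complex.measurable_re
  have hnrem : Measurable fun z : ℂ => -z.re := Complex.measurable_re.neg
  have himm : Measurable fun z : ℂ => z.im := Complex.measurable_im
  have hnimm : Measurable fun z : ℂ => -z.im := Complex.measurable_im.neg
  have hrele : ∀ z : ℂ, (fun z : ℂ => z.re) z ≤ ‖z‖ := fun z => Complex.re_le_norm z
  have hnrele : ∀ z : ℂ, (fun z : ℂ => -z.re) z ≤ ‖z‖ := fun z =>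
    (neg_le_abs _).trans (Complex.abs_re_le_norm z)
  have himle : ∀ z : ℂ, (fun z : ℂ => z.im) z ≤ ‖z‖ := fun z => Complex.im_le_norm z
  have hnimle : ∀ z : ℂ, (fun z : ℂ => -z.im) z ≤ ‖z‖ := fun z =>
    (neg_le_abs _).trans (Complex.abs_im_le_norm z)
  refine ⟨⟨hfin _ hrem hre0 hrele, hfin _ hnrem hnre0 hnrele, hfin _ himm him0 himle,
    hfin _ hnimm hnim0 hnimle⟩, ?_⟩
  -- the Bochner side
  have hsub : truncatedTrace μ ν 𝓕 T' f - truncatedTrace μ ν 𝓕 T f = ∫ x, D x ∂μ := by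
    rw [truncatedTrace_def, truncatedTrace_def, ← integral_sub hint' hint]
  have hreint : ∫ x, (D x).re ∂μ =
      (C * ∫⁻ y, β y * ENNReal.ofReal (W y).re ∂νG).toReal -
        (C * ∫⁻ y, β y * ENNReal.ofReal (-(W y).re) ∂νG).toReal := by
    have h := integral_eq_lintegral_pos_part_sub_lintegral_neg_part hDint.re
    simp only [RCLike.re_to_complex] at h
    rw [h]
    change (∫⁻ x, ENNReal.ofReal ((fun z : ℂ => z.re) (D x)) ∂μ).toReal -
        (∫⁻ x, ENNReal.ofReal ((fun z : ℂ => -z.re) (D x)) ∂μ).toReal = _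
    rw [hlin _ hrem hre0, hlin _ hnrem hnre0]
  have himint : ∫ x, (D x).im ∂μ =
      (C * ∫⁻ y, β y * ENNReal.ofReal (W y).im ∂νG).toReal -
        (C * ∫⁻ y, β y * ENNReal.ofReal (-(W y).im) ∂νG).toReal := by
    have h := integral_eq_lintegral_pos_part_sub_lintegral_neg_part hDint.im
    simp only [RCLike.im_to_complex] at h
    rw [h]
    change (∫⁻ x, ENNReal.ofReal ((fun z : ℂ => z.im) (D x)) ∂μ).toReal -
        (∫⁻ x, ENNReal.ofReal ((fun z : ℂ => -z.im) (D x)) ∂μ).toReal = _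
    rw [hlin _ himm him0, hlin _ hnimm hnim0]
  rw [hsub, ← integral_re_add_im hDint]
  simp only [RCLike.re_to_complex, RCLike.im_to_complex, RCLike.I_to_complex]
  rw [hreint, himint]
  rfl

end Bridge

end UnitaryGroup

end Literature.NumberTheory.Automorphic
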